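import Mathlib
import Literature.NumberTheory.Sieve.FouvryTenenbaumLiouvilleProofs

/-!
# Bombieri–Vinogradov for plain progression sums of the Liouville function

Crux `stmt-Parity-14270` (`TableChowla`), line *helson-kronecker-inverse*, stub `stub_bv`
(= the route's support item `BVLiouville`, stmt-Parity-13324), helper file 1/2.

Main result (`bv_liouville_progression`): for every `A > 0` there are `B > 0`, `C ≥ 0`, `X₀` such
that for `X ≥ X₀`, every `Q ≤ X^{1/2} (log X)^{-B}`, arbitrary integer heights `N_q ≤ X` and
arbitrary REDUCED residues `a_q (mod q)`,

  `∑_{q ≤ Q} |∑_{n ≤ N_q, n ≡ a_q (q)} λ(n)| ≤ C X (log X)^{-A}`.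

This is the Bombieri–Vinogradov theorem for the Liouville function with one height per modulus and
WITHOUT the subtracted main term `φ(q)⁻¹ ∑_{(n,q)=1} λ(n)`.  Proof (classical, Iwaniec–Kowalski
Thm 17.4 / Fouvry–Tenenbaum 2021 Thm 1.8 for `f = λ`): `λ = 𝟙_□ ⋆ μ` turns the progression sum into
`∑_{k² ≤ N, (k,q)=1} ∑_{m ≤ N/k², m ≡ a k̄² (q)} μ(m)` (`abs_sum_liouville_progression_le_sum_sq`, from
the tree's `SiegelWalfiszLiouville.sum_liouville_progression_eq` and `FTLiouville.inner_progression_eq`);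
the squares `k ≤ (log X)^{A+2}` are handled by the PROVED Bombieri–Vinogradov theorem for `μ` with
per-modulus heights (`Literature.NumberTheory.Sieve.bombieriVinogradov_moebius`) for the discrepancy
part and by the PROVED uniform Siegel–Walfisz bound for `μ` with a coprimality condition
(`Literature.NumberTheory.Sieve.Polymath8a.sum_moebius_coprime_progression_le_uniform` fed with
`Literature.NumberTheory.LFunctions.SiegelWalfiszMoebius_holds`) for the main terms
`φ(q)⁻¹ ∑_{m ≤ M, (m,q)=1} μ(m)` (the divisor sum `∑_{q ≤ Q} 4^{ω(q)}/φ(q) ≤ (1 + log Q)⁸` is the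
tree's `BVMoebius.sum_four_pow_div_totient_le`); the larger squares trivially — the argument of the
tree's `FouvryTenenbaum2021_thm18_liouville_holds`, adapted to per-modulus heights and plain sums.
References: Iwaniec–Kowalski, *Analytic Number Theory* (2004), Thm 17.4; Fouvry–Tenenbaum,
Trans. AMS 375 (2022), Thm 1.8.
-/

namespace Summit.Parity.GeneralizedHardyLittlewood.Theorems.TableChowla.HelsonKroneckerInverse

open Finset Real ArithmeticFunction
open Literature.NumberTheory.Sieve Literature.NumberTheory.Sieve.BVMoebius
  Literature.NumberTheory.Sieve.FTLiouville
open Literature.NumberTheory.LFunctions.SiegelWalfiszLiouville (sum_liouville_progression_eq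
  sum_Ioc_inv_sq_le filter_isSquare_Ioc_eq_image)
open scoped ArithmeticFunction.Moebius

/-! ### `λ = 𝟙_□ ⋆ μ` in a reduced progression -/

/-- For a reduced residue `a (mod q)`:
`|∑_{n ≤ N, n ≡ a (q)} λ(n)| ≤ ∑_{k ≤ S} |∑_{m ≤ N/k², m ≡ a k̄² (q)} μ(m)|` for any `S ≥ ⌊√N⌋`
(`λ = 𝟙_□ ⋆ μ`; the squares not coprime to `q` contribute nothing, and for them the right side
carries the harmless junk residue `sqResidue = 1`). [folklore] -/
theorem abs_sum_liouville_progression_le_sum_sq {q : ℕ} {a : ZMod q} (ha : IsUnit a) (N : ℕ)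
    {S : ℕ} (hS : Nat.sqrt N ≤ S) :
    |∑ n ∈ (Icc 1 N).filter (fun n : ℕ => (n : ZMod q) = a), (liouville n : ℝ)| ≤
      ∑ k ∈ Ioc 0 S, |moebiusAPSum (N / (k * k)) q (sqResidue q a (k * k))| := by
  set D : ℕ → ℝ := fun s => if s.Coprime q then moebiusAPSum (N / s) q (a * ((s : ZMod q))⁻¹)
    else 0 with hD
  have h0 : ∑ n ∈ (Icc 1 N).filter (fun n : ℕ => (n : ZMod q) = a), (liouville n : ℝ) =
      ∑ s ∈ Ioc 0 N, (if IsSquare s then (1 : ℝ) else 0) * D s := by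
    rw [sum_liouville_progression_eq a N]
    refine sum_congr rfl fun s _ => ?_
    rw [inner_progression_eq ha]
  rw [h0]
  refine (abs_sum_le_sum_abs _ _).trans ?_
  have h1 : ∑ s ∈ Ioc 0 N, |(if IsSquare s then (1 : ℝ) else 0) * D s| =
      ∑ s ∈ (Ioc 0 N).filter IsSquare, |D s| := by
    rw [sum_filter]
    refine sum_congr rfl fun s _ => ?_
    split_ifs <;> simp
  rw [h1, filter_isSquare_Ioc_eq_image, sum_image]
  · calc ∑ k ∈ Ioc 0 (Nat.sqrt N), |D (k * k)|
        ≤ ∑ k ∈ Ioc 0 (Nat.sqrt N), |moebiusAPSum (N / (k * k)) q (sqResidue q a (k * k))| := by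
          refine sum_le_sum fun k _ => ?_
          simp only [hD, sqResidue]
          split_ifs
          · exact le_rfl
          · rw [abs_zero]; exact abs_nonneg _
      _ ≤ ∑ k ∈ Ioc 0 S, |moebiusAPSum (N / (k * k)) q (sqResidue q a (k * k))| :=
          sum_le_sum_of_subset_of_nonneg (Ioc_subset_Ioc_right hS) fun _ _ _ => abs_nonneg _
  · intro k₁ _ k₂ _ h
    exact Nat.mul_self_inj.1 h

/-! ### Trivial bounds -/

/-- The trivial bound `|∑_{m ≤ M, m ≡ b (q)} μ(m)| ≤ M/q + 1`. [folklore] -/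
theorem abs_moebiusAPSum_le (q M : ℕ) (b : ZMod q) :
    |moebiusAPSum M q b| ≤ (M : ℝ) / q + 1 := by
  unfold moebiusAPSum
  refine (abs_sum_le_sum_abs _ _).trans ?_
  calc ∑ m ∈ (Icc 1 M).filter (fun m : ℕ => (m : ZMod q) = b), |(μ m : ℝ)|
      ≤ ∑ _m ∈ (Icc 1 M).filter (fun m : ℕ => (m : ZMod q) = b), (1 : ℝ) :=
        sum_le_sum fun m _ => by exact_mod_cast abs_moebius_le_one
    _ = #((Icc 1 M).filter (fun m : ℕ => (m : ZMod q) = b)) := by simp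
    _ ≤ ((M / q + 1 : ℕ) : ℝ) := by exact_mod_cast card_filter_natCast_eq_le b M
    _ ≤ (M : ℝ) / q + 1 := by push_cast; gcongr; exact Nat.cast_div_le

/-- Summing the trivial bound over `q ≤ Q` with heights `M_q ≤ X`:
`∑_{q ≤ Q} |∑_{m ≤ M_q, m ≡ b_q (q)} μ(m)| ≤ X (1 + log Q) + Q`. [folklore] -/
theorem sum_abs_moebiusAPSum_le_trivial (Q : ℕ) {X : ℝ} (hX : 0 ≤ X) (M : ℕ → ℕ)
    (hM : ∀ q ∈ Icc 1 Q, (M q : ℝ) ≤ X) (b : (q : ℕ) → ZMod q) :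
    ∑ q ∈ Icc 1 Q, |moebiusAPSum (M q) q (b q)| ≤ X * (1 + Real.log Q) + Q := by
  calc ∑ q ∈ Icc 1 Q, |moebiusAPSum (M q) q (b q)|
      ≤ ∑ q ∈ Icc 1 Q, (X * ((q : ℝ))⁻¹ + 1) := by
        refine sum_le_sum fun q hq => ?_
        refine (abs_moebiusAPSum_le q (M q) (b q)).trans ?_
        rw [div_eq_mul_inv]
        have : (M q : ℝ) * ((q : ℝ))⁻¹ ≤ X * ((q : ℝ))⁻¹ :=
          mul_le_mul_of_nonneg_right (hM q hq) (inv_nonneg.2 (Nat.cast_nonneg _))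
        linarith
    _ = X * ∑ q ∈ Icc 1 Q, ((q : ℝ))⁻¹ + Q := by
        rw [sum_add_distrib, ← mul_sum, sum_const, Nat.card_Icc, Nat.add_sub_cancel, nsmul_eq_mul,
          mul_one]
    _ ≤ X * (1 + Real.log Q) + Q := by
        have := harmonic_Icc_le Q
        gcongr

/-- `N/k² ≤ X/k²` (as reals) for `N ≤ X`, `k ≥ 1`. [folklore] -/
theorem cast_div_sq_le {X : ℝ} {N k : ℕ} (hN : (N : ℝ) ≤ X) (hk : 1 ≤ k) :
    ((N / (k * k) : ℕ) : ℝ) ≤ X / (k : ℝ) ^ 2 := by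
  have hk0 : (0 : ℝ) < k := by exact_mod_cast hk
  calc ((N / (k * k) : ℕ) : ℝ) ≤ (N : ℝ) / ((k * k : ℕ) : ℝ) := Nat.cast_div_le
    _ ≤ X / (k : ℝ) ^ 2 := by
        push_cast; rw [sq]; exact div_le_div_of_nonneg_right hN (by positivity)

/-! ### The main terms `φ(q)⁻¹ ∑_{(m,q)=1} μ(m)` -/

/-- The shape in which the uniform Siegel–Walfisz bound for `μ` with a coprimality condition is
consumed: `|∑_{m ≤ M, (m,q)=1} μ(m)| ≤ C₁ 4^{ω(q)} X (log X)^{-B}` for `1 ≤ q`, `M ≤ X`, `X ≥ e`.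
PROVED from `Literature.NumberTheory.Sieve.Polymath8a.sum_moebius_coprime_progression_le_uniform`
(modulus `k = 1`) and `Literature.NumberTheory.LFunctions.SiegelWalfiszMoebius_holds`. [folklore] -/
theorem exists_abs_moebiusCoprimeSum_le (B : ℝ) (hB : 0 ≤ B) :
    ∃ C₁ : ℝ, 0 ≤ C₁ ∧ ∀ X : ℝ, Real.exp 1 ≤ X → ∀ q : ℕ, 1 ≤ q → ∀ M : ℕ, (M : ℝ) ≤ X →
      |moebiusCoprimeSum M q| ≤ C₁ * 4 ^ q.primeFactors.card * X / Real.log X ^ B := by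
  obtain ⟨C₁, hC₁0, hC₁⟩ := Polymath8a.sum_moebius_coprime_progression_le_uniform
    Literature.NumberTheory.LFunctions.SiegelWalfiszMoebius_holds (A := 1) one_pos hB
  refine ⟨C₁, hC₁0, fun X hX q hq M hM => ?_⟩
  have he : (2 : ℝ) ≤ Real.exp 1 := by have := Real.exp_one_gt_d9; linarith
  have hX2 : 2 ≤ X := he.trans hX
  have hX0 : 0 < X := by linarith
  have hlog1 : 1 ≤ Real.log X := (Real.le_log_iff_exp_le hX0).2 hX
  have hRHS0 : 0 ≤ C₁ * 4 ^ q.primeFactors.card * X / Real.log X ^ B := by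
    have : 0 ≤ Real.log X := by linarith
    positivity
  rcases Nat.eq_zero_or_pos M with rfl | hM0
  · simpa [moebiusCoprimeSum] using hRHS0
  have hM1 : (1 : ℝ) ≤ M := by exact_mod_cast hM0
  have key := hC₁ X hX2 1 le_rfl (by rw [Nat.cast_one, Real.rpow_one]; exact hlog1) (0 : ZMod 1)
    (isUnit_of_subsingleton _) q (by omega) M hM1 hM
  rw [Nat.floor_natCast] at key
  have hsum : ∑ n ∈ (Icc 1 M).filter (fun n : ℕ => (n : ZMod 1) = 0 ∧ n.Coprime q), (μ n : ℝ) =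
      moebiusCoprimeSum M q := by
    unfold moebiusCoprimeSum
    refine sum_congr (filter_congr fun n _ => ?_) fun _ _ => rfl
    simp [Subsingleton.elim (n : ZMod 1) 0]
  rw [hsum] at key
  exact key

/-- `|∑_{m ≤ M, m ≡ b (q)} μ(m)| ≤ |Δ_μ(M; q, b)| + φ(q)⁻¹ |∑_{m ≤ M, (m,q)=1} μ(m)|`. [folklore] -/
theorem abs_moebiusAPSum_le_disc_add (q M : ℕ) (b : ZMod q) :
    |moebiusAPSum M q b| ≤
      |moebiusDisc M q b| + ((Nat.totient q : ℝ))⁻¹ * |moebiusCoprimeSum M q| := by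
  have h : moebiusAPSum M q b =
      moebiusDisc M q b + ((Nat.totient q : ℝ))⁻¹ * moebiusCoprimeSum M q := by
    unfold moebiusDisc; ring
  have hφ : (0 : ℝ) ≤ ((Nat.totient q : ℝ))⁻¹ := inv_nonneg.2 (Nat.cast_nonneg _)
  calc |moebiusAPSum M q b|
      = |moebiusDisc M q b + ((Nat.totient q : ℝ))⁻¹ * moebiusCoprimeSum M q| := by rw [h]
    _ ≤ |moebiusDisc M q b| + |((Nat.totient q : ℝ))⁻¹ * moebiusCoprimeSum M q| := abs_add_le _ _
    _ = _ := by rw [abs_mul, abs_of_nonneg hφ]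

/-! ### The estimate for large `x` -/

set_option maxHeartbeats 800000 in
/-- **The estimate for large `x`.**  Assume the Bombieri–Vinogradov theorem for `μ` with saving
`(log x)^{-(2A+2)}` beyond `x₀` (the shape of `Literature.NumberTheory.Sieve.bombieriVinogradov_moebius`)
and the coprime main-term bound with saving `(log x)^{-(2A+10)}` for `x ≥ e` (the shape of
`exists_abs_moebiusCoprimeSum_le`).  Then for `x ≥ max(x₀, 1)` with `log x ≥ 2`,
`Q ≤ x^{1/2}(log x)^{-B_μ}`, `Q ≤ x^{1/2}`, heights `N_q ≤ x` and reduced residues `a_q`: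
`∑_{q ≤ Q} |∑_{n ≤ N_q, n ≡ a_q (q)} λ(n)| ≤ (C_μ + C₁ + 2) x/(log x)^A + x^{1/2} Q`
(the squares `k ≤ (log x)^{A+2}` by the two hypotheses at the heights `N_q/k²`, the larger squares
trivially). [folklore] -/
theorem sum_abs_liouville_progression_le_of_large {A Bμ Cμ C₁ x₀ : ℝ} (hA : 0 < A) (hCμ : 0 ≤ Cμ)
    (hC₁ : 0 ≤ C₁)
    (hBV : ∀ x : ℝ, x₀ ≤ x → ∀ Q : ℕ, (Q : ℝ) ≤ x ^ (1 / 2 : ℝ) / Real.log x ^ Bμ →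
      ∀ N : ℕ → ℕ, (∀ q, (N q : ℝ) ≤ x) → ∀ b : (q : ℕ) → ZMod q, (∀ q ∈ Icc 1 Q, IsUnit (b q)) →
        ∑ q ∈ Icc 1 Q, |moebiusDisc (N q) q (b q)| ≤ Cμ * x / Real.log x ^ (2 * A + 2))
    (hMT : ∀ X : ℝ, Real.exp 1 ≤ X → ∀ q : ℕ, 1 ≤ q → ∀ M : ℕ, (M : ℝ) ≤ X →
      |moebiusCoprimeSum M q| ≤ C₁ * 4 ^ q.primeFactors.card * X / Real.log X ^ (2 * A + 10))
    {x : ℝ} (hx₀ : x₀ ≤ x) (hx1 : 1 ≤ x) (hL : 2 ≤ Real.log x) {Q : ℕ}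
    (hQ : (Q : ℝ) ≤ x ^ (1 / 2 : ℝ) / Real.log x ^ Bμ) (hQs : (Q : ℝ) ≤ x ^ (1 / 2 : ℝ))
    (N : ℕ → ℕ) (hN : ∀ q, (N q : ℝ) ≤ x)
    (a : (q : ℕ) → ZMod q) (ha : ∀ q ∈ Icc 1 Q, IsUnit (a q)) :
    ∑ q ∈ Icc 1 Q, |∑ n ∈ (Icc 1 (N q)).filter (fun n : ℕ => (n : ZMod q) = a q),
        (liouville n : ℝ)| ≤ (Cμ + C₁ + 2) * x / Real.log x ^ A + x ^ (1 / 2 : ℝ) * Q := by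
  have hx0 : 0 < x := by linarith
  have hxe : Real.exp 1 ≤ x := (Real.le_log_iff_exp_le hx0).1 (by linarith)
  set X := ⌊x⌋₊ with hXdef
  set S := Nat.sqrt X with hSdef
  set L := Real.log x with hLdef
  set K₀ := ⌊L ^ (A + 2)⌋₊ with hK₀def
  set F : ℕ → ℝ := fun k => ∑ q ∈ Icc 1 Q,
    |moebiusAPSum (N q / (k * k)) q (sqResidue q (a q) (k * k))| with hFdef
  have hF0 : ∀ k, 0 ≤ F k := fun k => sum_nonneg fun _ _ => abs_nonneg _
  have hL0 : 0 < L := by linarith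
  have hL1 : 1 ≤ L := by linarith
  have hLp : ∀ e : ℝ, 0 < L ^ e := fun e => Real.rpow_pos_of_pos hL0 e
  have hLA2 : L ^ (A + 2) = L ^ (A + 1) * L := by
    rw [show (A + 2 : ℝ) = (A + 1) + 1 by ring, Real.rpow_add hL0, Real.rpow_one]
  have hL2A2 : L ^ (2 * A + 2) = L ^ A * L ^ (A + 2) := by
    rw [← Real.rpow_add hL0]; congr 1; ring
  have hL2A10 : L ^ (2 * A + 10) = L ^ (2 * A + 2) * L ^ 8 := by
    rw [show (2 * A + 10 : ℝ) = (2 * A + 2) + 8 by ring, Real.rpow_add hL0,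
      show (8 : ℝ) = ((8 : ℕ) : ℝ) by norm_num, Real.rpow_natCast]
  have hLA22 : 2 ≤ L ^ (A + 2) := by
    calc (2 : ℝ) ≤ L := hL
      _ = L ^ (1 : ℝ) := (Real.rpow_one L).symm
      _ ≤ L ^ (A + 2) := Real.rpow_le_rpow_of_exponent_le hL1 (by linarith)
  have hLAA1 : L ^ A ≤ L ^ (A + 1) := Real.rpow_le_rpow_of_exponent_le hL1 (by linarith)
  -- facts about `K₀`
  have hK₀le : (K₀ : ℝ) ≤ L ^ (A + 2) := Nat.floor_le (hLp _).le
  have hK₀lt : L ^ (A + 2) < K₀ + 1 := Nat.lt_floor_add_one _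
  have hK₀1 : 1 ≤ K₀ := Nat.le_floor (by norm_num; linarith)
  have hK₀0 : (0 : ℝ) < K₀ := by exact_mod_cast hK₀1
  have hK₀inv : (1 : ℝ) / K₀ ≤ 2 / L ^ (A + 2) := by
    rw [div_le_div_iff₀ hK₀0 (hLp _)]; linarith
  -- heights: `N q ≤ X`
  have hNX : ∀ q, N q ≤ X := fun q => Nat.le_floor (hN q)
  -- `1 + log Q ≤ L`
  have hlogQ : 1 + Real.log Q ≤ L := by
    rcases Nat.eq_zero_or_pos Q with rfl | hQ0
    · simp; linarith
    · have hQ1 : (1 : ℝ) ≤ Q := by exact_mod_cast hQ0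
      have h1 : Real.log Q ≤ Real.log (x ^ (1 / 2 : ℝ)) := Real.log_le_log (by linarith) hQs
      rw [Real.log_rpow hx0] at h1
      linarith
  have hlogQ0 : 0 ≤ 1 + Real.log Q := by
    have : 0 ≤ Real.log (Q : ℝ) := Real.log_natCast_nonneg Q; linarith
  -- the two deep inputs, for each `k`
  have hFk : ∀ k, F k ≤ (Cμ + C₁) * x / L ^ (2 * A + 2) := by
    intro k
    have hunit : ∀ q ∈ Icc 1 Q, IsUnit (sqResidue q (a q) (k * k)) :=
      fun q hq => isUnit_sqResidue (ha q hq) _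
    have hNk : ∀ q, ((N q / (k * k) : ℕ) : ℝ) ≤ x := fun q =>
      le_trans (by exact_mod_cast Nat.div_le_self (N q) (k * k)) (hN q)
    have h1 : ∑ q ∈ Icc 1 Q, |moebiusDisc (N q / (k * k)) q (sqResidue q (a q) (k * k))| ≤
        Cμ * x / L ^ (2 * A + 2) :=
      hBV x hx₀ Q hQ (fun q => N q / (k * k)) hNk (fun q => sqResidue q (a q) (k * k)) hunit
    have h2 : ∑ q ∈ Icc 1 Q, ((Nat.totient q : ℝ))⁻¹ * |moebiusCoprimeSum (N q / (k * k)) q| ≤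
        C₁ * x / L ^ (2 * A + 2) := by
      have hc0 : 0 ≤ C₁ * x / L ^ (2 * A + 10) := by positivity
      calc ∑ q ∈ Icc 1 Q, ((Nat.totient q : ℝ))⁻¹ * |moebiusCoprimeSum (N q / (k * k)) q|
          ≤ ∑ q ∈ Icc 1 Q, ((Nat.totient q : ℝ))⁻¹ *
              (C₁ * 4 ^ q.primeFactors.card * x / L ^ (2 * A + 10)) := by
            refine sum_le_sum fun q hq => ?_
            exact mul_le_mul_of_nonneg_left (hMT x hxe q (mem_Icc.1 hq).1 _ (hNk q))
              (inv_nonneg.2 (Nat.cast_nonneg _))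
        _ = C₁ * x / L ^ (2 * A + 10) *
              ∑ q ∈ Icc 1 Q, (4 : ℝ) ^ q.primeFactors.card / Nat.totient q := by
            rw [mul_sum]
            refine sum_congr rfl fun q _ => ?_
            rw [div_eq_mul_inv _ (Nat.totient q : ℝ)]
            ring
        _ ≤ C₁ * x / L ^ (2 * A + 10) * (1 + Real.log Q) ^ 8 :=
            mul_le_mul_of_nonneg_left (sum_four_pow_div_totient_le Q) hc0
        _ ≤ C₁ * x / L ^ (2 * A + 10) * L ^ 8 :=
            mul_le_mul_of_nonneg_left (pow_le_pow_left₀ hlogQ0 hlogQ 8) hc0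
        _ = C₁ * x / L ^ (2 * A + 2) := by
            rw [hL2A10]
            have h8 : (0 : ℝ) < L ^ 8 := by positivity
            have h22 : (0 : ℝ) < L ^ (2 * A + 2) := hLp _
            field_simp
    calc F k ≤ ∑ q ∈ Icc 1 Q, (|moebiusDisc (N q / (k * k)) q (sqResidue q (a q) (k * k))| +
          ((Nat.totient q : ℝ))⁻¹ * |moebiusCoprimeSum (N q / (k * k)) q|) :=
          sum_le_sum fun q _ => abs_moebiusAPSum_le_disc_add q _ _
      _ ≤ Cμ * x / L ^ (2 * A + 2) + C₁ * x / L ^ (2 * A + 2) := by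
          rw [sum_add_distrib]; exact add_le_add h1 h2
      _ = (Cμ + C₁) * x / L ^ (2 * A + 2) := by ring
  -- the trivial bound for each `k ≥ 1`
  have hFk' : ∀ k, 1 ≤ k → F k ≤ x * (1 / (k : ℝ) ^ 2) * L + Q := by
    intro k hk
    have hxk : 0 ≤ x / (k : ℝ) ^ 2 := by positivity
    have hM : ∀ q ∈ Icc 1 Q, ((N q / (k * k) : ℕ) : ℝ) ≤ x / (k : ℝ) ^ 2 :=
      fun q _ => cast_div_sq_le (hN q) hk
    refine (sum_abs_moebiusAPSum_le_trivial Q hxk _ hM _).trans ?_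
    have h1 : x / (k : ℝ) ^ 2 * (1 + Real.log Q) ≤ x / (k : ℝ) ^ 2 * L :=
      mul_le_mul_of_nonneg_left hlogQ hxk
    have e : x * (1 / (k : ℝ) ^ 2) = x / (k : ℝ) ^ 2 := by ring
    rw [e]
    linarith
  -- splitting the sum over `k` at `K₀`
  have hsplit : ∑ k ∈ Ioc 0 S, F k ≤ ∑ k ∈ Ioc 0 K₀, F k + ∑ k ∈ Ioc K₀ S, F k := by
    rcases le_or_gt K₀ S with h | h
    · rw [← sum_Ioc_consecutive F (Nat.zero_le K₀) h]
    · have he : Ioc K₀ S = ∅ := Finset.Ioc_eq_empty (by omega)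
      rw [he, sum_empty, add_zero]
      exact sum_le_sum_of_subset_of_nonneg (Ioc_subset_Ioc_right h.le) fun k _ _ => hF0 k
  -- the small squares
  have hmain : ∑ k ∈ Ioc 0 K₀, F k ≤ (Cμ + C₁) * x / L ^ A := by
    calc ∑ k ∈ Ioc 0 K₀, F k ≤ ∑ _k ∈ Ioc 0 K₀, (Cμ + C₁) * x / L ^ (2 * A + 2) :=
          sum_le_sum fun k _ => hFk k
      _ = K₀ * ((Cμ + C₁) * x / L ^ (2 * A + 2)) := by
          rw [sum_const, Nat.card_Ioc, Nat.sub_zero, nsmul_eq_mul]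
      _ ≤ L ^ (A + 2) * ((Cμ + C₁) * x / L ^ (2 * A + 2)) :=
          mul_le_mul_of_nonneg_right hK₀le (by positivity)
      _ = (Cμ + C₁) * x / L ^ A := by
          rw [hL2A2]
          have hA0 : (0 : ℝ) < L ^ A := hLp _
          have hA2 : (0 : ℝ) < L ^ (A + 2) := hLp _
          field_simp
  -- the large squares
  have hS : (S : ℝ) ≤ x ^ (1 / 2 : ℝ) := by
    have hSS : ((S * S : ℕ) : ℝ) ≤ X := by exact_mod_cast Nat.sqrt_le X
    push_cast at hSS
    have hS2 : (S : ℝ) ^ 2 ≤ x := by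
      calc (S : ℝ) ^ 2 = (S : ℝ) * S := sq _
        _ ≤ X := hSS
        _ ≤ x := Nat.floor_le hx0.le
    rw [← Real.sqrt_eq_rpow]
    calc (S : ℝ) = Real.sqrt ((S : ℝ) ^ 2) := (Real.sqrt_sq (Nat.cast_nonneg S)).symm
      _ ≤ Real.sqrt x := Real.sqrt_le_sqrt hS2
  have htail2 : x * L * (2 / L ^ (A + 2)) ≤ 2 * x / L ^ A := by
    have hA1 : (0 : ℝ) < L ^ (A + 1) := hLp _
    calc x * L * (2 / L ^ (A + 2)) = 2 * x / L ^ (A + 1) := by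
          rw [hLA2]; field_simp
      _ ≤ 2 * x / L ^ A := div_le_div_of_nonneg_left (by positivity) (hLp A) hLAA1
  have htail : ∑ k ∈ Ioc K₀ S, F k ≤ 2 * x / L ^ A + x ^ (1 / 2 : ℝ) * Q := by
    calc ∑ k ∈ Ioc K₀ S, F k ≤ ∑ k ∈ Ioc K₀ S, (x * (1 / (k : ℝ) ^ 2) * L + Q) :=
          sum_le_sum fun k hk => hFk' k (by have := (mem_Ioc.1 hk).1; omega)
      _ = x * L * ∑ k ∈ Ioc K₀ S, (1 / (k : ℝ) ^ 2) + #(Ioc K₀ S) * (Q : ℝ) := by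
          rw [sum_add_distrib, sum_const, nsmul_eq_mul, mul_sum]
          congr 1
          exact sum_congr rfl fun k _ => by ring
      _ ≤ x * L * (1 / K₀) + S * (Q : ℝ) := by
          gcongr
          · exact sum_Ioc_inv_sq_le hK₀1 S
          · rw [Nat.card_Ioc]; exact_mod_cast Nat.sub_le S K₀
      _ ≤ x * L * (2 / L ^ (A + 2)) + x ^ (1 / 2 : ℝ) * Q := by
          gcongr
      _ ≤ 2 * x / L ^ A + x ^ (1 / 2 : ℝ) * Q := by
          gcongr ?_ + _
  -- assembling
  have hLHS : ∑ q ∈ Icc 1 Q, |∑ n ∈ (Icc 1 (N q)).filter (fun n : ℕ => (n : ZMod q) = a q),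
      (liouville n : ℝ)| ≤ ∑ k ∈ Ioc 0 S, F k := by
    calc _ ≤ ∑ q ∈ Icc 1 Q, ∑ k ∈ Ioc 0 S,
          |moebiusAPSum (N q / (k * k)) q (sqResidue q (a q) (k * k))| :=
          sum_le_sum fun q hq => abs_sum_liouville_progression_le_sum_sq (ha q hq) (N q)
            (Nat.sqrt_le_sqrt (hNX q))
      _ = ∑ k ∈ Ioc 0 S, F k := sum_comm
  calc _ ≤ ∑ k ∈ Ioc 0 S, F k := hLHS
    _ ≤ (Cμ + C₁) * x / L ^ A + (2 * x / L ^ A + x ^ (1 / 2 : ℝ) * Q) :=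
        hsplit.trans (add_le_add hmain htail)
    _ = (Cμ + C₁ + 2) * x / L ^ A + x ^ (1 / 2 : ℝ) * Q := by ring

/-- **Bombieri–Vinogradov for plain progression sums of `λ` with per-modulus heights.** For every
`A > 0` there are `B > 0`, `C ≥ 0`, `X₀` such that for `X ≥ X₀`, `Q ≤ X^{1/2}(log X)^{-B}`,
integer heights `N_q ≤ X` and reduced residues `a_q (mod q)`:
`∑_{q ≤ Q} |∑_{n ≤ N_q, n ≡ a_q (q)} λ(n)| ≤ C X/(log X)^A`.  PROVED from the tree's
`bombieriVinogradov_moebius`, `Polymath8a.sum_moebius_coprime_progression_le_uniform` and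
`SiegelWalfiszMoebius_holds` (Iwaniec–Kowalski Thm 17.4 for `f = λ`; Fouvry–Tenenbaum Thm 1.8).
[folklore] -/
theorem bv_liouville_progression :
    ∀ A : ℝ, 0 < A → ∃ B C X₀ : ℝ, 0 < B ∧ 0 ≤ C ∧ ∀ X : ℝ, X₀ ≤ X →
      ∀ Q : ℕ, (Q : ℝ) ≤ X ^ (1 / 2 : ℝ) / Real.log X ^ B →
      ∀ N : ℕ → ℕ, (∀ q : ℕ, (N q : ℝ) ≤ X) →
      ∀ a : (q : ℕ) → ZMod q, (∀ q ∈ Finset.Icc 1 Q, IsUnit (a q)) →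
        ∑ q ∈ Finset.Icc 1 Q,
          |∑ n ∈ (Finset.Icc 1 (N q)).filter (fun n : ℕ => (n : ZMod q) = a q),
            (ArithmeticFunction.liouville n : ℝ)| ≤ C * X / Real.log X ^ A := by
  intro A hA
  obtain ⟨Bμ, Cμ, x₀, hBμ, hCμ, hBV⟩ := bombieriVinogradov_moebius (2 * A + 2) (by positivity)
  obtain ⟨C₁, hC₁, hMT⟩ := exists_abs_moebiusCoprimeSum_le (2 * A + 10) (by positivity)
  refine ⟨max Bμ A, Cμ + C₁ + 3, max (max x₀ 1) (Real.exp 2), lt_max_of_lt_left hBμ,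
    by positivity, fun X hX Q hQ N hN a ha => ?_⟩
  have hx₀ : x₀ ≤ X := le_trans (le_trans (le_max_left _ _) (le_max_left _ _)) hX
  have hX1 : 1 ≤ X := le_trans (le_trans (le_max_right _ _) (le_max_left _ _)) hX
  have hX0 : 0 < X := by linarith
  have hXe : Real.exp 2 ≤ X := le_trans (le_max_right _ _) hX
  have hL2 : 2 ≤ Real.log X := (Real.le_log_iff_exp_le hX0).2 hXe
  have hL1 : 1 ≤ Real.log X := by linarith
  have hL0 : 0 < Real.log X := by linarith
  have hLB : 1 ≤ Real.log X ^ max Bμ A :=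
    Real.one_le_rpow hL1 (le_trans hA.le (le_max_right _ _))
  have hQs : (Q : ℝ) ≤ X ^ (1 / 2 : ℝ) := hQ.trans (div_le_self (by positivity) hLB)
  have hQμ : (Q : ℝ) ≤ X ^ (1 / 2 : ℝ) / Real.log X ^ Bμ :=
    hQ.trans (div_le_div_of_nonneg_left (by positivity) (Real.rpow_pos_of_pos hL0 _)
      (Real.rpow_le_rpow_of_exponent_le hL1 (le_max_left _ _)))
  have hmain := sum_abs_liouville_progression_le_of_large hA hCμ hC₁ hBV hMT hx₀ hX1 hL2 hQμ
    hQs N hN a ha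
  have hLA : 0 < Real.log X ^ A := Real.rpow_pos_of_pos hL0 A
  have t2 : X ^ (1 / 2 : ℝ) * Q ≤ X / Real.log X ^ A := by
    calc X ^ (1 / 2 : ℝ) * Q ≤ X ^ (1 / 2 : ℝ) * (X ^ (1 / 2 : ℝ) / Real.log X ^ max Bμ A) :=
          mul_le_mul_of_nonneg_left hQ (by positivity)
      _ = X / Real.log X ^ max Bμ A := by
          rw [← mul_div_assoc, ← Real.rpow_add hX0]; norm_num
      _ ≤ X / Real.log X ^ A :=
          div_le_div_of_nonneg_left hX0.le hLA
            (Real.rpow_le_rpow_of_exponent_le hL1 (le_max_right _ _))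
  calc _ ≤ (Cμ + C₁ + 2) * X / Real.log X ^ A + X ^ (1 / 2 : ℝ) * Q := hmain
    _ ≤ (Cμ + C₁ + 2) * X / Real.log X ^ A + X / Real.log X ^ A := add_le_add le_rfl t2
    _ = (Cμ + C₁ + 3) * X / Real.log X ^ A := by ring

end Summit.Parity.GeneralizedHardyLittlewood.Theorems.TableChowla.HelsonKroneckerInverse
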